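import Summits.RiemannHypothesis.RiemannHypothesis.Theorems.TiltedLandingLaw421R3Lens1ArcSignE

/-!
# TiltedLandingLaw421R3 — lens-1: RUNG 3 of the arc-sign ladder TYPED in COUNT currency (part F, statements first)

LENS-1 gen-6 module image `rh33346-cover/lens-1/ArcSignF-v2.lean` (v2 = v1 with the count law over the NON-REAL zero count) (landing target `…/Theorems/TiltedLandingLaw421R3Lens1ArcSignF.lean`; single import =
part E; namespace `RhW08.Lens1ArcSign`; 0 `sorry`, no instances / notation).  Memo `O6d-RUNG3-COUNT-MEMO-v1.md` (O6-d, (CA569)).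

THE WORD OF A CIRCLE.  On `C_δ : |w − Re a| = Im a + δ` the upper semicircle `t ∈ [0, ½]` (`arcPhi`, part C) is cut at the real points of
`φ = f^{(j+1)}/f^{(j)}` into GOOD pieces (`Im φ < 0`) and BAD pieces (`Im φ > 0`); a bad piece from `Re φ < 0` to `Re φ > 0` is ASCENDING, from
`Re φ > 0` to `Re φ < 0` DESCENDING (`ascStarts`, `descStarts` = their earlier end points).  Part Dʼs potential argument gives the EXACT identity
`ch = U − #asc + #desc` on `LocalB` frames (`U` = upper zeros of `f^{(j)}` in the open disc with multiplicity = `1 + pz`; memo O6b (PIN)), of which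
RUNG 2 used only `#asc = 0 ⇒ ch ≥ U ≥ 1`.

RUNG 3 (NET, `PinningOfNetNonAscending`): hypothesis `ArcNetNonAsc` = on all small circles outside a finite set of radii, `#asc ≤ #desc` — a statement
about the cyclic sign word of `φ` on `C_δ` alone (no children, no events, no components); conclusion = the `TopPinning` disjunction.  It contains
RUNG 2 (`arcNetNonAsc_of_arcNoAscCofinite`) and pays the balanced class (T-ARC: the 35 `(asc, desc) = (1, 1)` cases of the 59).  CONVERSION
(`PinningOfArcCount`): hypothesis `ArcCountLaw` = `2(#asc − #desc) ≤ N − 2`, `N = nonrealZeroMult` = the non-real zeros of `f^{(j)}` in the open disc with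
multiplicity (`= 2U` by conjugation), the census form of the law itself — typed as the FRAME in
which every pay rule (component currency, memo §3) is an inequality on the word; `rung3_of_arcCount`, `rung2_of_rung3` order the ladder.  Both are
OPEN in this image (proof = part G: the exact piece identity); the residual after RUNG 3 is `TopPinningNetAscResidual` with the exact split.

HONEST LABEL: statements and bookkeeping only; `PinningOfNetNonAscending`, `PinningOfArcCount`, `TopPinningNetAscResidual`, `TopPinning`, 33346, 33347
are OPEN; nothing here bears on the truth of RH; RH is not proved; typed ≠ proved.
-/

noncomputable section

namespace RhW08.Lens1ArcSign

open Complex Set Metric Filter Topology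
open scoped Real
open Literature.Topology.PlaneTopology Literature.Analysis.Complex
open Summit.RiemannHypothesis.RiemannHypothesis.Theorems.Splittings.JensenWindow
open RhIdea6.G17.W07C7 RhIdea6.G17.W07C7.Rev6 RhIdea6.G18.W07C8.Law421BirthS RhIdea6.G19.W07C11.Seam
open RhIdea6.G20.W07C12.Frac RhIdea6.G20.W07C12.StColP RhW07.C12.FieldSplit RhIdea6.G21.W07C13.TentMax
open RhW07.C14.TwoSided RhW07.C14.Classes RhW07.C14.Lineage RhW07.C14.Booking
open RhW07.C13.Heredity RhIdea6.G22.W07C15pre.Injection RhW07.E3.Cell RhW07.E3.Lit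
open RhW08.Round1 RhW08.StSwap RhW08.Round2 RhW08.QuadW RhW08.SealSwapQ RhW08.SealSwap RhW08.SuccB RhW08.SuccSplit
open RhW08.SuccTheft RhW08.Column RhW08.Hurwitz RhW08.ClusterQ RhW08.ClusterQM RhW08.NewtonDoor RhW08.NewtonDoorGenusOne RhW08.PurseP
open RhW08.Lens1SignCut RhW08.Lens1Coverage RhW08.IsolatedTilt RhW08.Lens1Pinning RhW08.Lens1PinningIso

/-! ## §1 The pieces of the upper semicircle and their counts -/

/-- A BAD PIECE `(t₁, t₂) ⊆ [0, ½]` of the circle of radius `Im a + δ`: `Im φ > 0` strictly inside, `φ` real at both ends (consecutive real points of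
`φ`, touching zeros of `Im φ` included — the counts below are partition-invariant). -/
def BadPiece (f : ℂ → ℂ) (j : ℕ) (a : ℂ) (δ t₁ t₂ : ℝ) : Prop :=
  0 ≤ t₁ ∧ t₁ < t₂ ∧ t₂ ≤ 1 / 2 ∧ (∀ t ∈ Ioo t₁ t₂, 0 < (arcPhi f j a δ t).im) ∧ (arcPhi f j a δ t₁).im = 0 ∧ (arcPhi f j a δ t₂).im = 0

/-- Earlier end points of the ASCENDING bad pieces (`Re φ < 0` at `t₁`, `Re φ > 0` at `t₂`). -/
def ascStarts (f : ℂ → ℂ) (j : ℕ) (a : ℂ) (δ : ℝ) : Set ℝ :=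
  {t₁ | ∃ t₂, BadPiece f j a δ t₁ t₂ ∧ (arcPhi f j a δ t₁).re < 0 ∧ 0 < (arcPhi f j a δ t₂).re}

/-- Earlier end points of the DESCENDING bad pieces (`Re φ > 0` at `t₁`, `Re φ < 0` at `t₂`). -/
def descStarts (f : ℂ → ℂ) (j : ℕ) (a : ℂ) (δ : ℝ) : Set ℝ :=
  {t₁ | ∃ t₂, BadPiece f j a δ t₁ t₂ ∧ 0 < (arcPhi f j a δ t₁).re ∧ (arcPhi f j a δ t₂).re < 0}

/-- Non-real zeros of `G` in the open disc `|w − c| < r`, with multiplicity — the censusʼs `N_D(G) − N_D^ℝ(G)`; for real `G = f^{(j)}`, `c = Re a`,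
`r = Im a + δ` small it is `2U = 2(1 + pz)` (`a`, the interior foreign upper zeros, and their conjugates). -/
def nonrealZeroMult (G : ℂ → ℂ) (c r : ℝ) : ℤ :=
  ∑ᶠ ρ ∈ {ρ : ℂ | G ρ = 0 ∧ ρ ∈ ball (c : ℂ) r ∧ ρ.im ≠ 0}, (meromorphicOrderAt G ρ).untop₀

/-- RUNG-3 HYPOTHESIS at radius excess `δ` (NET NON-ASCENT): finitely many ascending bad pieces, and at most as many as descending ones. -/
def NetNonAscending (f : ℂ → ℂ) (j : ℕ) (a : ℂ) (δ : ℝ) : Prop :=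
  (ascStarts f j a δ).Finite ∧ (ascStarts f j a δ).ncard ≤ (descStarts f j a δ).ncard

/-- `ArcNetNonAsc f j a`: net non-ascent on every small circle outside a finite set of radii. -/
def ArcNetNonAsc (f : ℂ → ℂ) (j : ℕ) (a : ℂ) : Prop :=
  ∃ d0 > 0, ∃ E : Set ℝ, E.Finite ∧ ∀ δ ∈ Ioo 0 d0 \ E, NetNonAscending f j a δ

/-- COUNT-LAW HYPOTHESIS at `δ`: `2(#asc − #desc) ≤ N − 2` (`N = nonrealZeroMult`, i.e. `#asc − #desc ≤ pz`), the census form of `ch ≥ 1`. -/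
def ArcCountIneq (f : ℂ → ℂ) (j : ℕ) (a : ℂ) (δ : ℝ) : Prop :=
  (ascStarts f j a δ).Finite ∧
    2 * (((ascStarts f j a δ).ncard : ℤ) - (descStarts f j a δ).ncard) ≤ nonrealZeroMult (iteratedDeriv j f) a.re (a.im + δ) - 2

/-- `ArcCountLaw f j a`: the count inequality on every small circle outside a finite set of radii. -/
def ArcCountLaw (f : ℂ → ℂ) (j : ℕ) (a : ℂ) : Prop :=
  ∃ d0 > 0, ∃ E : Set ℝ, E.Finite ∧ ∀ δ ∈ Ioo 0 d0 \ E, ArcCountIneq f j a δ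

/-- ★ RUNG 3 (STATEMENT; OPEN in this image): net non-ascent on the small circles ⇒ the `TopPinning` disjunction. -/
def PinningOfNetNonAscending : Prop :=
  ∀ (η : ℝ) (f : ℂ → ℂ) (x₀ s hmax R Hs : ℝ) (B : ℕ), EngineHyps5 2 η f x₀ s hmax R Hs B → ∀ (j : ℕ) (a : ℂ),
    iteratedDeriv j f a = 0 → 0 < a.im → ArcNetNonAsc f j a →
    (∃ w : ℂ, iteratedDeriv (j + 1) f w = 0 ∧ w.im ≠ 0 ∧ NestedStep a w) ∨ (∃ x : ℝ, |x - a.re| ≤ a.im ∧ NLEventOf f j x)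

/-- ★ CONVERSION (STATEMENT; OPEN in this image): the count law on the small circles ⇒ the `TopPinning` disjunction. -/
def PinningOfArcCount : Prop :=
  ∀ (η : ℝ) (f : ℂ → ℂ) (x₀ s hmax R Hs : ℝ) (B : ℕ), EngineHyps5 2 η f x₀ s hmax R Hs B → ∀ (j : ℕ) (a : ℂ),
    iteratedDeriv j f a = 0 → 0 < a.im → ArcCountLaw f j a →
    (∃ w : ℂ, iteratedDeriv (j + 1) f w = 0 ∧ w.im ≠ 0 ∧ NestedStep a w) ∨ (∃ x : ℝ, |x - a.re| ≤ a.im ∧ NLEventOf f j x)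

/-! ## §2 The ladder is ordered: RUNG 2 ⊆ RUNG 3 ⊆ CONVERSION -/

/-- No ascending bad arc ⇒ no ascending piece. -/
theorem ascStarts_eq_empty_of_noAscendingArc {f : ℂ → ℂ} {j : ℕ} {a : ℂ} {δ : ℝ} (h : NoAscendingArc f j a δ) : ascStarts f j a δ = ∅ := by
  ext t₁
  simp only [ascStarts, mem_setOf_eq, mem_empty_iff_false, iff_false, not_exists, not_and]
  intro t₂ hB hre₁ hre₂
  obtain ⟨h₁, h12, h₂, hpos, him₁, him₂⟩ := hB
  exact h t₁ t₂ h₁ h12 h₂ hpos him₁ him₂ ⟨hre₁, hre₂⟩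

/-- RUNG 2ʼs hypothesis at `δ` ⇒ RUNG 3ʼs. -/
theorem netNonAscending_of_noAscendingArc {f : ℂ → ℂ} {j : ℕ} {a : ℂ} {δ : ℝ} (h : NoAscendingArc f j a δ) : NetNonAscending f j a δ := by
  refine ⟨?_, ?_⟩ <;> rw [ascStarts_eq_empty_of_noAscendingArc h]
  · exact Set.finite_empty
  · simp

/-- `ArcNoAscCofinite ⇒ ArcNetNonAsc` (hence `ArcNoAsc ⇒ ArcNetNonAsc`). -/
theorem arcNetNonAsc_of_arcNoAscCofinite {f : ℂ → ℂ} {j : ℕ} {a : ℂ} (h : ArcNoAscCofinite f j a) : ArcNetNonAsc f j a := by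
  obtain ⟨d0, hd0, E, hE, hna⟩ := h
  exact ⟨d0, hd0, E, hE, fun δ hδ => netNonAscending_of_noAscendingArc (hna δ hδ)⟩

/-- ★ RUNG 3 ⇒ RUNG 2 (cofinite form, hence `PinningOfNoAscendingArc`). -/
theorem rung2_of_rung3 (h3 : PinningOfNetNonAscending) : PinningOfNoAscendingArc :=
  fun η f x₀ s hmax R Hs B hE j a ha hapos hNA =>
    h3 η f x₀ s hmax R Hs B hE j a ha hapos (arcNetNonAsc_of_arcNoAscCofinite (arcNoAscCofinite_of_arcNoAsc hNA))

/-- Net non-ascent ⇒ the count inequality, as soon as `N ≥ 2`. -/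
theorem arcCountIneq_of_netNonAscending {f : ℂ → ℂ} {j : ℕ} {a : ℂ} {δ : ℝ} (hU : 2 ≤ nonrealZeroMult (iteratedDeriv j f) a.re (a.im + δ))
    (h : NetNonAscending f j a δ) : ArcCountIneq f j a δ := by
  refine ⟨h.1, ?_⟩
  have h2 : ((ascStarts f j a δ).ncard : ℤ) ≤ (descStarts f j a δ).ncard := by exact_mod_cast h.2
  linarith

/-- For an entire `G ≢ 0`, orders are non-negative and positive at zeros. -/
theorem untop₀_order_pos {G : ℂ → ℂ} (hG : Differentiable ℂ G) (hne : G ≠ 0) {ρ : ℂ} (h0 : G ρ = 0) :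
    0 < (meromorphicOrderAt G ρ).untop₀ := by
  have han : AnalyticAt ℂ G ρ := hG.analyticAt ρ
  have hnot : analyticOrderAt G ρ ≠ ⊤ := by
    intro htop
    rw [analyticOrderAt_eq_top] at htop
    apply hne
    funext w
    exact (hG.differentiableOn.analyticOnNhd isOpen_univ).eqOn_zero_of_preconnected_of_eventuallyEq_zero isPreconnected_univ (mem_univ ρ) htop
      (mem_univ w)
  rw [han.meromorphicOrderAt_eq]
  cases hq : analyticOrderAt G ρ with
  | top => exact absurd hq hnot
  | coe n =>
    have hn : n ≠ 0 := by
      intro hn0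
      rw [hn0] at hq
      exact ((han.analyticOrderAt_eq_zero).mp (by exact_mod_cast hq)) h0
    have : 0 < n := Nat.pos_of_ne_zero hn
    simpa using this

/-- `N ≥ 2` on every disc containing the upper zero `a` of a real `G ≢ 0` (`a` and `conj a`). -/
theorem two_le_nonrealZeroMult {G : ℂ → ℂ} (hG : Differentiable ℂ G) (hne : G ≠ 0) (hreal : ∀ x : ℝ, (G x).im = 0) {a : ℂ} (ha : G a = 0)
    (hapos : 0 < a.im) {δ : ℝ} (hδ : 0 < δ) : 2 ≤ nonrealZeroMult G a.re (a.im + δ) := by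
  classical
  have hr : 0 < a.im + δ := by linarith
  set L : ℝ := a.im + δ + 1 with hL
  have hz₀ : ((a.re : ℂ)) ∈ Ioo (a.re - L) (a.re + L) ×ℂ Ioo (-((a.im + δ) + 1)) ((a.im + δ) + 1) :=
    ofReal_mem_box (by rw [sub_self, abs_zero]; linarith) hr.le
  have hfin : {ρ : ℂ | G ρ = 0 ∧ ρ ∈ ball (a.re : ℂ) (a.im + δ) ∧ ρ.im ≠ 0}.Finite := by
    refine (finite_zeros_box hG hne hz₀).subset ?_
    rintro ρ ⟨h0, hρ, -⟩
    refine ⟨h0, ?_⟩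
    rw [mem_ball, dist_eq_norm] at hρ
    have h1 := abs_re_le_norm (ρ - (a.re : ℂ))
    have h2 := abs_im_le_norm (ρ - (a.re : ℂ))
    rw [sub_re, ofReal_re, abs_le] at h1
    rw [sub_im, ofReal_im, sub_zero, abs_le] at h2
    exact mem_reProdIm.2 ⟨⟨by linarith [h1.1], by linarith [h1.2]⟩, ⟨by linarith [h2.1], by linarith [h2.2]⟩⟩
  have hnorm : ∀ w : ℂ, w.re = a.re → |w.im| = a.im → w ∈ ball ((a.re : ℝ) : ℂ) (a.im + δ) := by
    intro w hre him
    rw [mem_ball, dist_eq_norm]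
    have e : w - (a.re : ℂ) = ((w.im : ℝ) : ℂ) * I := Complex.ext (by simp [hre]) (by simp)
    rw [e, norm_mul, Complex.norm_real, Complex.norm_I, mul_one, Real.norm_eq_abs, him]
    linarith
  have haS : a ∈ hfin.toFinset := by
    rw [Set.Finite.mem_toFinset]
    exact ⟨ha, hnorm a rfl (abs_of_pos hapos), hapos.ne'⟩
  have hbS : (starRingEnd ℂ) a ∈ hfin.toFinset := by
    rw [Set.Finite.mem_toFinset]
    refine ⟨by rw [apply_conj_eq_conj hG hreal, ha, map_zero], hnorm _ (by simp) (by simp [abs_of_pos hapos]), ?_⟩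
    simpa using hapos.ne'
  have hab : a ≠ (starRingEnd ℂ) a := fun h => by
    have := congrArg Complex.im h
    simp at this; linarith
  unfold nonrealZeroMult
  rw [finsum_mem_eq_finite_toFinset_sum _ hfin]
  have hpos : ∀ ρ ∈ hfin.toFinset, 0 < (meromorphicOrderAt G ρ).untop₀ := by
    intro ρ hρ
    rw [Set.Finite.mem_toFinset] at hρ
    exact untop₀_order_pos hG hne hρ.1
  have hsub : ({a, (starRingEnd ℂ) a} : Finset ℂ) ⊆ hfin.toFinset := by
    intro ρ hρ
    rcases Finset.mem_insert.1 hρ with rfl | hρ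
    · exact haS
    · rw [Finset.mem_singleton.1 hρ]; exact hbS
  have h1 := Finset.sum_le_sum_of_subset_of_nonneg hsub (fun ρ hρ _ => (hpos ρ hρ).le)
  rw [Finset.sum_pair hab] at h1
  have h2 := hpos a haS
  have h3 := hpos _ hbS
  omega

/-- ★ CONVERSION ⇒ RUNG 3 (the degenerate frame `f^{(j)} ≡ 0` is settled by the child `w = a`). -/
theorem rung3_of_arcCount (hC : PinningOfArcCount) : PinningOfNetNonAscending := by
  intro η f x₀ s hmax R Hs B hE j a ha hapos hN
  classical
  by_cases hnz : iteratedDeriv j f = 0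
  · left
    refine ⟨a, ?_, hapos.ne', ?_⟩
    · rw [iteratedDeriv_succ, hnz]; simp
    · show (a.re - a.re) ^ 2 + a.im ^ 2 ≤ a.im ^ 2
      simp
  have hf : RealEntireLt2 f := realEntireLt2_of_hyps hE
  have hGd : Differentiable ℂ (iteratedDeriv j f) := differentiable_iteratedDeriv_of_entire hf.diff j
  have hGreal : ∀ x : ℝ, (iteratedDeriv j f x).im = 0 := im_iteratedDeriv_ofReal hf.diff hf.real j
  obtain ⟨d0, hd0, E, hEfin, hna⟩ := hN
  refine hC η f x₀ s hmax R Hs B hE j a ha hapos ⟨d0, hd0, E, hEfin, fun δ hδ => ?_⟩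
  exact arcCountIneq_of_netNonAscending (two_le_nonrealZeroMult hGd hnz hGreal ha hapos hδ.1.1) (hna δ hδ)

/-! ## §3 The typed residual after RUNG 3 and the exact split -/

/-- The NET-ASCENDING residual of the law: zeros with crossing mates, not arc-sign clear, with an ascending arc on arbitrarily small circles, and
NOT net non-ascending (`¬ ArcNetNonAsc`).  OPEN; in component currency (memo §3) its pay is «a net-ascending `Ω_a` borders an interior zero». -/
def TopPinningNetAscResidual : Prop :=
  ∀ (η : ℝ) (f : ℂ → ℂ) (x₀ s hmax R Hs : ℝ) (B : ℕ), EngineHyps5 2 η f x₀ s hmax R Hs B → ∀ (j : ℕ) (a : ℂ),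
    iteratedDeriv j f a = 0 → 0 < a.im → NoTallerToucher f j a → ¬ JensenIsolated f j a → ¬ ArcSignClear f j a → ¬ ArcNoAsc f j a →
    ¬ ArcNetNonAsc f j a →
    (∃ w : ℂ, iteratedDeriv (j + 1) f w = 0 ∧ w.im ≠ 0 ∧ NestedStep a w) ∨ (∃ x : ℝ, |x - a.re| ≤ a.im ∧ NLEventOf f j x)

/-- ★ EXACT SPLIT: RUNG 3 and the net-ascending residual give the ascending residual (hence, with RUNG 2, the law). -/
theorem ascResidual_of_rung3 (h3 : PinningOfNetNonAscending) (h4 : TopPinningNetAscResidual) : TopPinningAscResidual := by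
  intro η f x₀ s hmax R Hs B hE j a ha hapos hN hJ hS hA
  by_cases hM : ArcNetNonAsc f j a
  · exact h3 η f x₀ s hmax R Hs B hE j a ha hapos hM
  · exact h4 η f x₀ s hmax R Hs B hE j a ha hapos hN hJ hS hA hM

/-- ★ The law from RUNG 3 and the net-ascending residual (RUNG 2 is implied). -/
theorem topPinning_of_rung3 (h3 : PinningOfNetNonAscending) (h4 : TopPinningNetAscResidual) : TopPinning :=
  topPinning_of_rung2 (rung2_of_rung3 h3) (ascResidual_of_rung3 h3 h4)

/-- Converse (bookkeeping): the split is exact. -/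
theorem netAscResidual_of_topPinning (hP : TopPinning) : TopPinningNetAscResidual :=
  fun η f x₀ s hmax R Hs B hE j a ha hapos hN _ _ _ _ => hP η f x₀ s hmax R Hs B hE j a ha hapos hN

/-- The conversion closes the ladder: `PinningOfArcCount` and the net-ascending residual give the law. -/
theorem topPinning_of_arcCount (hC : PinningOfArcCount) (h4 : TopPinningNetAscResidual) : TopPinning :=
  topPinning_of_rung3 (rung3_of_arcCount hC) h4

end RhW08.Lens1ArcSign
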